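import Mathlib.FieldTheory.Fixed
import Mathlib.RingTheory.LocalRing.ResidueField.Basic
import Mathlib.LinearAlgebra.Matrix.NonsingularInverse
import Mathlib.RingTheory.Flat.FaithfullyFlat.Basic
import Literature.AlgebraicGeometry.Resolution.RegularLocalRingsFlatDescent
import HarnessLib

/-!
# Invariants of a finite group acting on a local ring with trivial inertia: freeness, `𝔪` extends, regularity descends

Topic: `Literature/AlgebraicGeometry/Resolution`. PROOF side of `CossartPiltant2019ReductionP`
(`ArithmeticalThreefoldsLocal.lean`), input (C4), INERTIA LAYER of [CoP1] Prop. 9.3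
(`ArithmeticalThreefoldsLocalDescentLayers.lean`, hypothesis `hInert`): "the invariant ring
`S₀ˢ := (S₀ⁱ)^{Gˢ(W/V)/Gⁱ(W/V)} ⊂ Kˢ` is a normal local model of `Vˢ/k` … `S₀ⁱ` is local-étale
over `S₀ˢ` … so that `S₀ˢ` is regular" (HAL p. 27). The commutative algebra behind this sentence
is the classical étale descent for the invariants of a finite group acting with TRIVIAL INERTIA,
i.e. Chase–Harrison–Rosenberg's criterion (f) of their Thm. 1.3 ("for each `σ ≠ 1` in `G` and
each maximal ideal `p` of `S` there is `s ∈ S` with `σ(s) − s ∉ p`") read for a LOCAL ring `C`: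

Let `G` be a finite group acting on a local ring `(C, 𝔪_C, k)` by ring automorphisms, and let
`R → C` be (an injective ring map onto) the ring of invariants, such that every `g ≠ 1` moves
some element of `C` by a unit (`g • c − c ∈ C×`, i.e. `G` acts faithfully on the residue field).
Then (Dedekind's independence of the automorphisms of `k` over `k^G`, Artin's `[k : k^G] = |G|`,
and the inverse of Dedekind's matrix `(g • c_j)_{g,j}` for lifts `c_j` of a `k^G`-basis of `k`):

* `exists_basis_of_isUnit_smul_sub` — PROVED: `C` is a FREE `R`-module of rank `|G|` on lifts
  of a `k^G`-basis of `k`, and a linear combination `∑ a_j c_j` (`a_j ∈ R`) lies in `𝔪_C` only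
  if all `a_j` do [CHR Thm. 1.3 (f) ⇒ (b)];
* `isUnit_iff_isUnit_algebraMap_of_fixedPoints`, `isLocalRing_of_fixedPoints`,
  `isLocalHom_of_fixedPoints` — PROVED: `R` is local and `R → C` is a local homomorphism;
* `free_of_isUnit_smul_sub`, `finite_of_isUnit_smul_sub`, `finrank_eq_card_of_isUnit_smul_sub`
  — PROVED: `C` is finite free of rank `|G|` over `R`;
* `map_maximalIdeal_eq_of_isUnit_smul_sub` — PROVED: `𝔪_R C = 𝔪_C` (the extension is
  unramified at the closed point);
* `isNoetherianRing_of_isUnit_smul_sub` — PROVED: `R` is Noetherian if `C` is (faithfully flat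
  descent);
* `isRegularLocalRing_of_isUnit_smul_sub` — PROVED: **`R` is a regular local ring if `C` is**
  (flat local descent of regularity, Matsumura Thm. 23.7 (i), tree
  `RegularLocalRingsFlatDescent.lean`).

Everything is PROVED; no named facts, definitions, instances or notation are introduced.

## Sources

* S. U. Chase, D. K. Harrison, A. Rosenberg, *Galois theory and Galois cohomology of commutative
  rings*, Mem. AMS 52 (1965), Thm. 1.3 ((f) ⇒ (a), (b): `S` is a finitely generated projective
  `R`-module and `S ⊗_R S ≅ ∏_G S`) and Lemma 1.2. [ChaseHarrisonRosenberg1965]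
* A. Grothendieck, M. Raynaud, SGA 1, Exp. V, §2 (inertia groups; "si le groupe d'inertie est
  réduit à l'élément neutre, `X` est étale sur `Y = X/G` en `x`"). [SGA1]
* H. Matsumura, *Commutative Ring Theory* (1986), Thm. 23.7 (i). [Matsumura1987]
* V. Cossart, O. Piltant, J. Algebra 320 (2008), proof of Prop. 9.3 (HAL hal-00139124, p. 27).
  [CossartPiltant2008]
-/

noncomputable section

open IsLocalRing Module

namespace Literature.AlgebraicGeometry.Resolution

universe u v

section TrivialInertia

variable {R C : Type u} [CommRing R] [CommRing C] [IsLocalRing C] [Algebra R C]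
  {G : Type v} [Group G] [Fintype G] [MulSemiringAction G C]

omit [IsLocalRing C] [Fintype G] in
/-- **Units of the ring of invariants.** If `R → C` is injective onto the `G`-invariants of `C`,
then `r ∈ R` is a unit iff its image is a unit of `C` (the inverse of an invariant unit is
invariant). [cite: ChaseHarrisonRosenberg1965, Lemma 1.2 and Thm. 1.3] -/
theorem isUnit_iff_isUnit_algebraMap_of_fixedPoints
    (hGR : ∀ (g : G) (r : R), g • algebraMap R C r = algebraMap R C r)
    (hfix : ∀ c : C, (∀ g : G, g • c = c) → c ∈ Set.range (algebraMap R C))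
    (hinj : Function.Injective (algebraMap R C)) (r : R) :
    IsUnit r ↔ IsUnit (algebraMap R C r) := by
  refine ⟨fun h => h.map _, fun h => ?_⟩
  obtain ⟨w, hw⟩ := isUnit_iff_exists_inv.mp h
  have hwfix : ∀ g : G, g • w = w := by
    intro g
    have h1 : algebraMap R C r * (g • w) = 1 := by
      have := congrArg (fun x => g • x) hw
      simpa only [smul_mul', hGR, smul_one] using this
    calc g • w = g • w * (algebraMap R C r * w) := by rw [hw, mul_one]
      _ = (algebraMap R C r * (g • w)) * w := by ring
      _ = w := by rw [h1, one_mul]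
  obtain ⟨s, hs⟩ := hfix w hwfix
  refine isUnit_iff_exists_inv.mpr ⟨s, hinj ?_⟩
  rw [map_mul, hs, hw, map_one]

omit [Fintype G] in
/-- **The ring of invariants of a local ring is local.**
[cite: ChaseHarrisonRosenberg1965, Lemma 1.2 and Thm. 1.3] -/
theorem isLocalRing_of_fixedPoints
    (hGR : ∀ (g : G) (r : R), g • algebraMap R C r = algebraMap R C r)
    (hfix : ∀ c : C, (∀ g : G, g • c = c) → c ∈ Set.range (algebraMap R C))
    (hinj : Function.Injective (algebraMap R C)) : IsLocalRing R := by
  haveI : Nontrivial R := (algebraMap R C).domain_nontrivial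
  refine IsLocalRing.of_nonunits_add fun a b ha hb => ?_
  rw [mem_nonunits_iff, isUnit_iff_isUnit_algebraMap_of_fixedPoints hGR hfix hinj,
    ← mem_nonunits_iff, ← IsLocalRing.mem_maximalIdeal] at ha hb ⊢
  rw [map_add]
  exact Ideal.add_mem _ ha hb

omit [IsLocalRing C] [Fintype G] in
/-- **`R → C` is a local homomorphism** (for `R` the ring of invariants).
[cite: ChaseHarrisonRosenberg1965, Lemma 1.2 and Thm. 1.3] -/
theorem isLocalHom_of_fixedPoints
    (hGR : ∀ (g : G) (r : R), g • algebraMap R C r = algebraMap R C r)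
    (hfix : ∀ c : C, (∀ g : G, g • c = c) → c ∈ Set.range (algebraMap R C))
    (hinj : Function.Injective (algebraMap R C)) : IsLocalHom (algebraMap R C) :=
  ⟨fun r hr => (isUnit_iff_isUnit_algebraMap_of_fixedPoints hGR hfix hinj r).mpr hr⟩

/-- **Chase–Harrison–Rosenberg, Thm. 1.3 (f) ⇒ (b), local case, with Dedekind's matrix.** Let the
finite group `G` act on the local ring `C` by ring automorphisms fixing (the image of) `R`, with
`R → C` injective onto the invariants, and suppose every `g ≠ 1` moves some element by a unit
("`σ(s) − s ∉ p`": trivial inertia). Then `C` has an `R`-basis `(c_j)_{j ∈ G}` — lifts of a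
`k^G`-basis of the residue field `k`, `[k : k^G] = |G|` by Artin's theorem — such that
`∑ a_j c_j ∈ 𝔪_C` (`a_j ∈ R`) forces every `a_j` into `𝔪_C`. Proof: Dedekind's matrix
`M = (g • c_j)_{g, j}` is invertible in `C` (its residue is invertible by the independence of the
automorphisms of `k`); `∑ a_j c_j = 0` gives `M · a = 0`, so `a = 0`; for `x ∈ C` the solution
`v = M⁻¹ (g • x)_g` of `M v = (g • x)_g` is `G`-invariant (apply `h ∈ G` to the system), hence
in `R`, and its row `g = 1` reads `x = ∑ v_j c_j`.
[cite: ChaseHarrisonRosenberg1965, Thm. 1.3 ((f) ⇒ (b)) and its proof] -/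
theorem exists_basis_of_isUnit_smul_sub
    (hGR : ∀ (g : G) (r : R), g • algebraMap R C r = algebraMap R C r)
    (hfix : ∀ c : C, (∀ g : G, g • c = c) → c ∈ Set.range (algebraMap R C))
    (hinj : Function.Injective (algebraMap R C))
    (hI : ∀ g : G, g ≠ 1 → ∃ c : C, IsUnit (g • c - c)) :
    ∃ b : Module.Basis G R C,
      ∀ a : G → R, (∑ j, a j • b j) ∈ maximalIdeal C →
        ∀ j, algebraMap R C (a j) ∈ maximalIdeal C := by
  classical
  -- `G` acts `R`-linearly
  have hlin : ∀ (g : G) (r : R) (c : C), g • (r • c) = r • (g • c) := fun g r c => by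
    rw [Algebra.smul_def, Algebra.smul_def, smul_mul', hGR]
  -- the residue field `k` with its induced `G`-action
  let k := ResidueField C
  letI act : MulSemiringAction G k :=
    MulSemiringAction.compHom k
      ((ResidueField.mapAut (R := C)).comp (MulSemiringAction.toRingAut G C))
  have hπ : ∀ (g : G) (c : C), g • residue C c = residue C (g • c) := fun g c => rfl
  have hπs : Function.Surjective (residue C) := residue_surjective
  -- the action on `k` is faithful (trivial inertia)
  haveI : FaithfulSMul G k := ⟨fun {g₁ g₂} h => by
    by_contra hne
    obtain ⟨c, hc⟩ := hI (g₂⁻¹ * g₁) (fun h1 => hne (inv_mul_eq_one.mp h1).symm)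
    have h1 : (g₂⁻¹ * g₁) • residue C c = residue C c := by
      rw [mul_smul, h (residue C c), inv_smul_smul]
    rw [hπ, ← sub_eq_zero, ← map_sub] at h1
    exact (hc.map (residue C)).ne_zero h1⟩
  -- Artin: `[k : k^G] = |G|`; a `k^G`-basis of `k` indexed by `G`, and lifts
  let K := FixedPoints.subfield G k
  have hcard : Module.finrank K k = Fintype.card G := FixedPoints.finrank_eq_card G k
  let bK : Module.Basis G K k :=
    (Module.finBasisOfFinrankEq K k hcard).reindex (Fintype.equivFin G).symm
  let c : G → C := fun j => (hπs (bK j)).choose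
  have hc : ∀ j, residue C (c j) = bK j := fun j => (hπs (bK j)).choose_spec
  -- Dedekind's matrix and its invertibility
  let M : Matrix G G C := Matrix.of fun g j => g • c j
  have hMv : ∀ (v : G → C) (g : G), (Matrix.mulVec M v) g = ∑ j, (g • c j) * v j :=
    fun v g => rfl
  have hM : IsUnit M.det := by
    let Mk : Matrix G G k := Matrix.of fun g j => g • (bK j : k)
    have hmap : (residue C).mapMatrix M = Mk := by
      ext g j
      simp only [RingHom.mapMatrix_apply, Matrix.map_apply, Matrix.of_apply, M, Mk, ← hπ, hc]
    have hli : LinearIndependent k Mk.row := by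
      have hD := (linearIndependent_toLinearMap K k k).comp (FixedPoints.toAlgHomEquiv G k)
        (FixedPoints.toAlgHomEquiv G k).injective
      rw [Fintype.linearIndependent_iff] at hD ⊢
      intro l hl g
      refine hD l (Module.Basis.ext bK fun j => ?_) g
      have hj := congrFun hl j
      simp only [Finset.sum_apply, Pi.smul_apply, smul_eq_mul, Pi.zero_apply, Matrix.row,
        Matrix.of_apply, Mk] at hj
      rw [LinearMap.zero_apply, LinearMap.coe_sum, Finset.sum_apply]
      simp only [Function.comp_apply, LinearMap.smul_apply, AlgHom.toLinearMap_apply,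
        smul_eq_mul]
      refine Eq.trans (Finset.sum_congr rfl fun x _ => ?_) hj
      rfl
    have hMk : IsUnit Mk.det :=
      (Matrix.isUnit_iff_isUnit_det _).mp (Matrix.linearIndependent_rows_iff_isUnit.mp hli)
    have hdet : residue C M.det ≠ 0 := by
      rw [RingHom.map_det, hmap]
      exact hMk.ne_zero
    exact (residue_ne_zero_iff_isUnit _).mp hdet
  have hMinj : ∀ v w : G → C, Matrix.mulVec M v = Matrix.mulVec M w → v = w := fun v w h => by
    have := congrArg (fun z => Matrix.mulVec M⁻¹ z) h
    simpa only [Matrix.mulVec_mulVec, Matrix.nonsing_inv_mul _ hM, Matrix.one_mulVec] using this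
  -- the lifts are linearly independent over `R`
  have hli : LinearIndependent R c := by
    rw [Fintype.linearIndependent_iff]
    intro a ha j
    have h1 : Matrix.mulVec M (fun j => algebraMap R C (a j)) = Matrix.mulVec M 0 := by
      funext g
      rw [hMv, hMv]
      simp only [Pi.zero_apply, mul_zero, Finset.sum_const_zero]
      have := congrArg (fun x => g • x) ha
      simp only [smul_zero, Finset.smul_sum, hlin] at this
      simpa only [Algebra.smul_def, mul_comm] using this
    have h2 := congrFun (hMinj _ _ h1) j
    exact hinj (by simpa using h2)
  -- and they span: `x = ∑ v_j c_j` with `v = M⁻¹ (g • x)_g` invariant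
  have hsp : ∀ x : C, ∃ a : G → R, x = ∑ j, a j • c j := by
    intro x
    let y : G → C := fun g => g • x
    let v : G → C := Matrix.mulVec M⁻¹ y
    have hv : Matrix.mulVec M v = y := by
      simp only [v, Matrix.mulVec_mulVec, Matrix.mul_nonsing_inv _ hM, Matrix.one_mulVec]
    have hvfix : ∀ (h : G) (j : G), h • v j = v j := by
      intro h j
      have key : Matrix.mulVec M (fun j => h • v j) = y := by
        funext g
        rw [hMv]
        have e1 := congrFun hv (h⁻¹ * g)
        rw [hMv] at e1
        have e2 := congrArg (fun z => h • z) e1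
        simp only [Finset.smul_sum, smul_mul', smul_smul, mul_inv_cancel_left, y] at e2
        exact e2
      exact congrFun (hMinj _ _ (key.trans hv.symm)) j
    choose a ha using fun j => hfix (v j) (fun h => hvfix h j)
    refine ⟨a, ?_⟩
    have e1 := congrFun hv 1
    rw [hMv] at e1
    simp only [one_smul, y] at e1
    rw [← e1]
    refine Finset.sum_congr rfl fun j _ => ?_
    rw [Algebra.smul_def, ha, mul_comm]
  let b : Module.Basis G R C := Module.Basis.mk hli (by
    rintro x -
    obtain ⟨a, rfl⟩ := hsp x
    exact Submodule.sum_mem _ fun j _ =>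
      Submodule.smul_mem _ _ (Submodule.subset_span ⟨j, rfl⟩))
  have hb : ⇑b = c := Module.Basis.coe_mk _ _
  refine ⟨b, fun a ha j => ?_⟩
  rw [hb] at ha
  -- reduce modulo `𝔪_C`: a `k^G`-linear relation among the `bK j`
  have h1 : ∑ j, residue C (algebraMap R C (a j)) * bK j = 0 := by
    have := (residue_eq_zero_iff _).mpr ha
    rw [map_sum] at this
    simpa only [Algebra.smul_def, map_mul, hc] using this
  have h2 : ∀ (j : G) (g : G),
      g • residue C (algebraMap R C (a j)) = residue C (algebraMap R C (a j)) :=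
    fun j g => by rw [hπ, hGR]
  let κ : G → K := fun j => ⟨residue C (algebraMap R C (a j)), fun g => h2 j g⟩
  have h3 : ∑ j, κ j • bK j = 0 := by
    have : ∀ j, κ j • bK j = residue C (algebraMap R C (a j)) * bK j := fun j => rfl
    simpa only [this] using h1
  have h4 := (Fintype.linearIndependent_iff.mp bK.linearIndependent) κ h3 j
  have h5 : residue C (algebraMap R C (a j)) = 0 := by
    have := congrArg Subtype.val h4
    simpa only [κ, ZeroMemClass.coe_zero] using this
  exact (residue_eq_zero_iff _).mp h5

/-- **`C` is a free `R`-module** (over its invariants, trivial inertia).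
[cite: ChaseHarrisonRosenberg1965, Thm. 1.3 ((f) ⇒ (b))] -/
theorem free_of_isUnit_smul_sub
    (hGR : ∀ (g : G) (r : R), g • algebraMap R C r = algebraMap R C r)
    (hfix : ∀ c : C, (∀ g : G, g • c = c) → c ∈ Set.range (algebraMap R C))
    (hinj : Function.Injective (algebraMap R C))
    (hI : ∀ g : G, g ≠ 1 → ∃ c : C, IsUnit (g • c - c)) : Module.Free R C := by
  obtain ⟨b, -⟩ := exists_basis_of_isUnit_smul_sub hGR hfix hinj hI
  exact Module.Free.of_basis b

/-- **`C` is a finite `R`-module** (over its invariants, trivial inertia).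
[cite: ChaseHarrisonRosenberg1965, Thm. 1.3 ((f) ⇒ (b))] -/
theorem finite_of_isUnit_smul_sub
    (hGR : ∀ (g : G) (r : R), g • algebraMap R C r = algebraMap R C r)
    (hfix : ∀ c : C, (∀ g : G, g • c = c) → c ∈ Set.range (algebraMap R C))
    (hinj : Function.Injective (algebraMap R C))
    (hI : ∀ g : G, g ≠ 1 → ∃ c : C, IsUnit (g • c - c)) : Module.Finite R C := by
  obtain ⟨b, -⟩ := exists_basis_of_isUnit_smul_sub hGR hfix hinj hI
  exact Module.Finite.of_basis b

/-- **`rank_R C = |G|`** (over its invariants, trivial inertia; `R` is non-trivial as a subring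
of the local ring `C`). [cite: ChaseHarrisonRosenberg1965, Thm. 1.3 ((f) ⇒ (b)) and Lemma 4.1] -/
theorem finrank_eq_card_of_isUnit_smul_sub
    (hGR : ∀ (g : G) (r : R), g • algebraMap R C r = algebraMap R C r)
    (hfix : ∀ c : C, (∀ g : G, g • c = c) → c ∈ Set.range (algebraMap R C))
    (hinj : Function.Injective (algebraMap R C))
    (hI : ∀ g : G, g ≠ 1 → ∃ c : C, IsUnit (g • c - c)) :
    Module.finrank R C = Fintype.card G := by
  haveI : Nontrivial R := (algebraMap R C).domain_nontrivial
  obtain ⟨b, -⟩ := exists_basis_of_isUnit_smul_sub hGR hfix hinj hI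
  rw [Module.finrank_eq_card_basis b]

/-- **The closed fibre is a point: `𝔪_R C = 𝔪_C`** — the extension `R → C` of local rings is
unramified at the closed point (the coefficients of an element of `𝔪_C` in the basis of lifts lie
in `𝔪_C ∩ R = 𝔪_R`). [cite: ChaseHarrisonRosenberg1965, Thm. 1.3 ((f) ⇒ (a)); SGA1, Exp. V §2] -/
theorem map_maximalIdeal_eq_of_isUnit_smul_sub [IsLocalRing R]
    (hGR : ∀ (g : G) (r : R), g • algebraMap R C r = algebraMap R C r)
    (hfix : ∀ c : C, (∀ g : G, g • c = c) → c ∈ Set.range (algebraMap R C))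
    (hinj : Function.Injective (algebraMap R C))
    (hI : ∀ g : G, g ≠ 1 → ∃ c : C, IsUnit (g • c - c)) :
    (maximalIdeal R).map (algebraMap R C) = maximalIdeal C := by
  haveI := isLocalHom_of_fixedPoints hGR hfix hinj
  apply le_antisymm
  · exact Ideal.map_le_iff_le_comap.mpr fun r hr => map_nonunit (algebraMap R C) r hr
  · intro x hx
    obtain ⟨b, hb⟩ := exists_basis_of_isUnit_smul_sub hGR hfix hinj hI
    rw [← b.sum_repr x] at hx ⊢
    refine Ideal.sum_mem _ fun j _ => ?_
    rw [Algebra.smul_def]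
    refine Ideal.mul_mem_right _ _ (Ideal.mem_map_of_mem _ ?_)
    have h := hb (fun j => b.repr x j) hx j
    exact (IsLocalRing.mem_maximalIdeal _).mpr fun hu =>
      (IsLocalRing.mem_maximalIdeal _).mp h (hu.map _)

/-- **Noetherianity descends**: if `C` is Noetherian then so is its ring of invariants `R`
(`C` is free of positive rank, hence faithfully flat, over `R`, so `I ↦ IC` is injective and
monotone on ideals). [cite: ChaseHarrisonRosenberg1965, Thm. 1.3 ((f) ⇒ (b)); Matsumura1987, Thm. 7.5] -/
theorem isNoetherianRing_of_isUnit_smul_sub [IsNoetherianRing C]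
    (hGR : ∀ (g : G) (r : R), g • algebraMap R C r = algebraMap R C r)
    (hfix : ∀ c : C, (∀ g : G, g • c = c) → c ∈ Set.range (algebraMap R C))
    (hinj : Function.Injective (algebraMap R C))
    (hI : ∀ g : G, g ≠ 1 → ∃ c : C, IsUnit (g • c - c)) : IsNoetherianRing R := by
  haveI : Nontrivial R := (algebraMap R C).domain_nontrivial
  haveI := free_of_isUnit_smul_sub hGR hfix hinj hI
  haveI : Module.FaithfullyFlat R C := inferInstance
  refine (monotone_stabilizes_iff_noetherian.mp fun f => ?_)
  let g : ℕ →o Ideal C :=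
    ⟨fun n => Ideal.map (algebraMap R C) (f n), fun m n hmn => Ideal.map_mono (f.monotone hmn)⟩
  obtain ⟨n, hn⟩ := monotone_stabilizes_iff_noetherian.mpr (inferInstance : IsNoetherian C C) g
  refine ⟨n, fun m hm => ?_⟩
  rw [← Ideal.comap_map_eq_self_of_faithfullyFlat (B := C) (f n),
    ← Ideal.comap_map_eq_self_of_faithfullyFlat (B := C) (f m)]
  exact congrArg (Ideal.comap (algebraMap R C)) (hn m hm)

omit [IsLocalRing C] in
/-- **Regularity descends to the invariants** ("`S₀ⁱ` is local-étale over `S₀ˢ` … so that `S₀ˢ`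
is regular"): if the finite group `G` acts on the REGULAR local ring `C` with trivial inertia
(every `g ≠ 1` moves some element by a unit) and `R → C` is injective onto the invariants, then
`R` is a regular local ring — `R` is local and Noetherian, `C` is free over `R`, `R → C` is local,
and regularity descends along flat local homomorphisms (Matsumura Thm. 23.7 (i)).
[cite: CossartPiltant2008, proof of Prop. 9.3 (HAL p. 27); ChaseHarrisonRosenberg1965, Thm. 1.3; Matsumura1987, Thm. 23.7 (i)] -/
theorem isRegularLocalRing_of_isUnit_smul_sub [IsRegularLocalRing C]
    (hGR : ∀ (g : G) (r : R), g • algebraMap R C r = algebraMap R C r)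
    (hfix : ∀ c : C, (∀ g : G, g • c = c) → c ∈ Set.range (algebraMap R C))
    (hinj : Function.Injective (algebraMap R C))
    (hI : ∀ g : G, g ≠ 1 → ∃ c : C, IsUnit (g • c - c)) : IsRegularLocalRing R := by
  haveI : IsLocalRing R := isLocalRing_of_fixedPoints hGR hfix hinj
  haveI : IsNoetherianRing C := IsRegularLocalRing.toIsNoetherian
  haveI : IsNoetherianRing R := isNoetherianRing_of_isUnit_smul_sub hGR hfix hinj hI
  haveI := free_of_isUnit_smul_sub hGR hfix hinj hI
  haveI : Module.Flat R C := inferInstance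
  haveI := isLocalHom_of_fixedPoints hGR hfix hinj
  exact IsRegularLocalRing.of_flat_of_isLocalHom R C

end TrivialInertia

end Literature.AlgebraicGeometry.Resolution

end
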